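import Literature.MathematicalPhysics.KineticTheory.InfiniteChainTransferPeeling
import HarnessLib

/-!
# The un-normalised Gibbs integral of an interval of a nearest-neighbour chain, peeled from both
# sides down to iterates of the transfer kernel

Topic `Literature/MathematicalPhysics/KineticTheory`; theorems only (no definitions, no named
facts). Sequel of `InfiniteChainTransferPeeling.lean` (path weights
`∏_{i<M} k(σ_{c+i}, σ_{c+i+1}) w(σ_{c+i+1})`, the pointwise transfer operator
`(κ F)(x) = ∫⁻ k(x, y) w(y) F(y) dν(y)`, and the one-block peel `lmarginal_Icc_pathWeight_mul`), on the
configuration space `ℤ → S` with a priori measure `ν`, one-site weight `w` and bond kernel `k`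
(oscillator chain: `S = ℝ × ℝ`, `w = e^{-(p²/2+U(q))/T}`, `k = e^{-V(q'-q)/T}`).

* `lmarginal_interval_eq_iterate` — **the two-sided peel**: for a window `{a, …, b}` (`b = a + n`)
  with `N` sites added on each side (volume `{ℓ+1, …, r-1}`, `ℓ = a-N-1`, `r = b+N+1`) and a
  measurable observable `Φ ≥ 0` of the window, the un-normalised Gibbs integral
  `∫⋯∫⁻_{ℓ+1,…,r-1} Φ · ∏ w · ∏ k` with boundary spins `η_ℓ, η_r` equals
  `κ^N [x ↦ ∫⁻ m_Φ(x, y) w(y) (κ^N k(·, η_r))(y) dν(y)] (η_ℓ)`, with the WINDOW KERNEL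
  `m_Φ(x, y) = ∫⋯∫⁻_{a,…,b-1} Φ · (path weight of the window from a-1) · k(σ_{b-1}, σ_b)` at
  `σ_{a-1} = x`, `σ_b = y` — i.e. the matrix element `⟪κ^N k(η_ℓ, ·), M_Φ κ^N k(·, η_r)⟫` in which
  the spectral gap of the transfer operator makes the dependence on the boundary spins disappear
  (`Literature.Analysis.OperatorTheory.exists_kernelRatio_tendsto_uniformly`).

This is the "interval kernel = transfer-operator matrix element" step of the classical proof of
uniqueness of the (tempered / shift-invariant) Gibbs state of one-dimensional models with strictly
positive transfer kernels (Cassandro–Olivieri–Pellegrinotti–Presutti 1978 §2; Georgii 2011,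
Thm 10.25, §11.1). Proof: split the volume into left block, window and right block
(`lmarginal_union`), peel the two blocks, integrate the window with its last site outermost.
[folklore]
-/

noncomputable section

open MeasureTheory Set Function Finset Literature.Probability.LatticeModels
open scoped ENNReal

namespace Literature.MathematicalPhysics.KineticTheory.HeatConduction

variable {S : Type*} [MeasurableSpace S] {ν : Measure S} {k : S → S → ℝ≥0∞} {w : S → ℝ≥0∞}

/-! ### The two-sided peel of an interval -/

/-- **The un-normalised finite-volume Gibbs integral of a window observable, peeled from both
sides.** Let `Φ ≥ 0` be a measurable observable of the window `{a, …, b}` (`b = a + n`), let `N`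
sites be added on each side (`ℓ = a - N - 1`, `r = b + N + 1`, volume `{ℓ+1, …, r-1}`), and let
`η` carry the boundary spins `η_ℓ, η_r`. Then
`∫⋯∫⁻_{ℓ+1,…,r-1} Φ(σ) ∏_{x} w(σ_x) ∏_{y=ℓ}^{r-1} k(σ_y, σ_{y+1})
 = κ^N [x ↦ ∫⁻ m_Φ(x, y) w(y) (κ^N k(·, η_r))(y) dν(y)] (η_ℓ)`,
where `m_Φ(x, y) = (∫⋯∫⁻_{a,…,b-1} Φ · ∏_{i<n} k(σ_{a-1+i}, σ_{a+i}) w(σ_{a+i}) · k(σ_{b-1}, σ_b))`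
evaluated at any configuration with `σ_{a-1} = x`, `σ_b = y` (here: `η₀` updated at `a-1` and `b`)
is the window kernel. Proof: split the volume into the left block, the window and the right block
(`lmarginal_union`), peel the two blocks with `lmarginal_Icc_pathWeight_mul`, and integrate the
window with its last site outermost. [folklore] -/
theorem lmarginal_interval_eq_iterate [SigmaFinite ν] (hk : Measurable (uncurry k))
    (hw : Measurable w) {Φ : (ℤ → S) → ℝ≥0∞} (hΦ : Measurable Φ) {a b ℓ r : ℤ} {n N : ℕ}
    (hb : a + n = b) (hℓ : ℓ + N + 1 = a) (hr : b + N + 1 = r)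
    (hΦd : DependsOn Φ (↑(Finset.Icc a b) : Set ℤ)) (η₀ η : ℤ → S) :
    (∫⋯∫⁻_Finset.Icc (ℓ + 1) (r - 1), (fun σ => Φ σ *
        ((∏ x ∈ Finset.Icc (ℓ + 1) (r - 1), w (σ x)) * ∏ y ∈ Finset.Icc ℓ (r - 1), k (σ y) (σ (y + 1))))
      ∂fun _ : ℤ => ν) η =
      ((fun G : S → ℝ≥0∞ => fun x => ∫⁻ y, k x y * w y * G y ∂ν)^[N] (fun x => ∫⁻ y,
        (∫⋯∫⁻_Finset.Icc a (b - 1), (fun σ => Φ σ *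
            ((∏ i ∈ Finset.range n, k (σ (a - 1 + i)) (σ (a - 1 + i + 1)) * w (σ (a - 1 + i + 1))) *
              k (σ (b - 1)) (σ b))) ∂fun _ : ℤ => ν)
          (Function.update (Function.update η₀ (a - 1) x) b y) * w y *
        (((fun G : S → ℝ≥0∞ => fun x => ∫⁻ y, k x y * w y * G y ∂ν)^[N] fun z => k z (η r)) y) ∂ν))
        (η ℓ) := by
  classical
  -- notation: the transfer step `κ`, the path weights `P c M`, the right-block function `g`
  set κ : (S → ℝ≥0∞) → S → ℝ≥0∞ := fun G x => ∫⁻ y, k x y * w y * G y ∂ν with hκ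
  obtain ⟨P, hP⟩ : ∃ P : ℤ → ℕ → (ℤ → S) → ℝ≥0∞, ∀ c M σ, P c M σ =
      ∏ i ∈ Finset.range M, k (σ (c + i)) (σ (c + i + 1)) * w (σ (c + i + 1)) :=
    ⟨_, fun _ _ _ => rfl⟩
  have hPf : ∀ c M, P c M = fun σ =>
      ∏ i ∈ Finset.range M, k (σ (c + i)) (σ (c + i + 1)) * w (σ (c + i + 1)) :=
    fun c M => funext (hP c M)
  have hPm : ∀ c M, Measurable (P c M) := fun c M => by
    rw [hPf]; exact measurable_pathWeight hk hw c M
  have hPd : ∀ c M, DependsOn (P c M) (↑(Finset.Icc c (c + M)) : Set ℤ) := fun c M => by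
    rw [hPf]; exact dependsOn_pathWeight c M
  have hPadd : ∀ c M M' σ, P c (M + M') σ = P c M σ * P (c + M) M' σ := fun c M M' σ => by
    rw [hP, hP, hP]; exact pathWeight_add c M M' σ
  have hPsucc : ∀ c M σ, P c (M + 1) σ = P c M σ * (k (σ (c + M)) (σ (c + M + 1)) * w (σ (c + M + 1))) :=
    fun c M σ => by rw [hP, hP, Finset.prod_range_succ]
  have hPpeel : ∀ (c : ℤ) (M : ℕ) (F : S → ℝ≥0∞), Measurable F → ∀ τ : ℤ → S,
      (∫⋯∫⁻_Finset.Icc (c + 1) (c + M), (fun σ => P c M σ * F (σ (c + M))) ∂fun _ : ℤ => ν) τ =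
        (κ^[M] F) (τ c) := fun c M F hF τ => by
    simp only [hP]; exact lmarginal_Icc_pathWeight_mul hk hw hF c M τ
  have hkr : ∀ v : S, Measurable fun z => k z v := fun v =>
    hk.comp (measurable_id.prodMk measurable_const)
  have hkij : ∀ i j : ℤ, Measurable fun σ : ℤ → S => k (σ i) (σ j) := fun i j =>
    measurable_kernel_eval hk i j
  set g : S → ℝ≥0∞ := κ^[N] fun z => k z (η r) with hg
  have hgm : Measurable g := measurable_transferStep_iterate hk hw (hkr _) N
  -- index facts
  have e1 : ℓ + (N : ℤ) = a - 1 := by omega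
  have e2 : a - 1 + ((n + 1 : ℕ) : ℤ) = b := by push_cast; omega
  have e3 : r - 1 = ℓ + ((N + (n + 1 + N) : ℕ) : ℤ) := by push_cast; omega
  have e4 : r - 1 = b + (N : ℤ) := by omega
  have e5 : a - 1 + (n : ℤ) = b - 1 := by omega
  have e6 : b - 1 + 1 = b := by omega
  -- Step 0: the integrand as a product of path weights
  have h0 : (fun σ : ℤ → S => Φ σ * ((∏ x ∈ Finset.Icc (ℓ + 1) (r - 1), w (σ x)) *
      ∏ y ∈ Finset.Icc ℓ (r - 1), k (σ y) (σ (y + 1)))) =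
      fun σ => P ℓ N σ * (Φ σ * (P (a - 1) (n + 1 + N) σ * k (σ (r - 1)) (σ r))) := by
    funext σ
    rw [e3, prod_Icc_siteWeight_mul_prod_Icc_bond, ← e3, sub_add_cancel, ← hP, hPadd ℓ N, e1]
    ring
  -- measurability of the pieces
  have hI2m : Measurable fun σ : ℤ → S => Φ σ * (P (a - 1) (n + 1 + N) σ * k (σ (r - 1)) (σ r)) :=
    hΦ.mul ((hPm _ _).mul (hkij _ _))
  have hIm : Measurable fun σ : ℤ → S =>
      P ℓ N σ * (Φ σ * (P (a - 1) (n + 1 + N) σ * k (σ (r - 1)) (σ r))) := (hPm _ _).mul hI2m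
  -- the inner (window + right block) integral `J` and its dependence on `{a-1, r}`
  set J : (ℤ → S) → ℝ≥0∞ := ∫⋯∫⁻_Finset.Icc a (r - 1),
    (fun σ => Φ σ * (P (a - 1) (n + 1 + N) σ * k (σ (r - 1)) (σ r))) ∂fun _ : ℤ => ν with hJ
  have hI2d : DependsOn (fun σ : ℤ → S => Φ σ * (P (a - 1) (n + 1 + N) σ * k (σ (r - 1)) (σ r)))
      (↑(Finset.Icc (a - 1) r) : Set ℤ) := by
    intro x y hxy
    simp only [Finset.coe_Icc, Set.mem_Icc] at hxy
    have hΦ' : Φ x = Φ y := hΦd fun i hi => by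
      simp only [Finset.coe_Icc, Set.mem_Icc] at hi; exact hxy i ⟨by omega, by omega⟩
    have hP' : P (a - 1) (n + 1 + N) x = P (a - 1) (n + 1 + N) y := hPd _ _ fun i hi => by
      simp only [Finset.coe_Icc, Set.mem_Icc] at hi; push_cast at hi; exact hxy i ⟨by omega, by omega⟩
    simp only [hΦ', hP', hxy (r - 1) ⟨by omega, by omega⟩, hxy r ⟨by omega, le_rfl⟩]
  have hJd : DependsOn J ((↑(Finset.Icc (a - 1) r) : Set ℤ) \ ↑(Finset.Icc a (r - 1))) := by
    rw [hJ]; exact dependsOn_lmarginal (μ := fun _ : ℤ => ν) _ hI2d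
  have hJm : Measurable J := by rw [hJ]; exact Measurable.lmarginal (fun _ : ℤ => ν) hI2m
  -- `F x = J` at the configuration `η` updated at `a - 1`
  set F : S → ℝ≥0∞ := fun x => J (Function.update η (a - 1) x) with hF
  have hFm : Measurable F := hJm.comp (measurable_update η)
  -- Step 1: split off the left block and peel it
  have hvol1 : Finset.Icc (ℓ + 1) (r - 1) = Finset.Icc (ℓ + 1) (ℓ + N) ∪ Finset.Icc a (r - 1) := by
    ext i; simp only [Finset.mem_union, Finset.mem_Icc]; omega
  have hdisj1 : Disjoint (Finset.Icc (ℓ + 1) (ℓ + N)) (Finset.Icc a (r - 1)) := by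
    rw [Finset.disjoint_left]; intro i hi hi'; simp only [Finset.mem_Icc] at hi hi'; omega
  have hdisj1' : Disjoint (Finset.Icc a (r - 1)) (Finset.Icc ℓ (ℓ + N)) := by
    rw [Finset.disjoint_left]; intro i hi hi'; simp only [Finset.mem_Icc] at hi hi'; omega
  have hinner1 : (∫⋯∫⁻_Finset.Icc a (r - 1), (fun σ => P ℓ N σ * (Φ σ * (P (a - 1) (n + 1 + N) σ *
      k (σ (r - 1)) (σ r)))) ∂fun _ : ℤ => ν) = fun σ => P ℓ N σ * J σ := by
    funext σ
    rw [hJ]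
    exact lmarginal_mul_left_of_dependsOn' (ν := ν) (hPd ℓ N) hdisj1' hI2m σ
  have hJF : ∀ σ : ℤ → S, (∀ x ∉ Finset.Icc (ℓ + 1) (ℓ + N), σ x = η x) →
      J σ = F (σ (ℓ + N)) := by
    intro σ hσ
    simp only [hF]
    refine hJd fun i hi => ?_
    simp only [Set.mem_sdiff, Finset.coe_Icc, Set.mem_Icc, not_and, not_le] at hi
    rcases eq_or_ne i (a - 1) with h | h
    · rw [h, Function.update_self, e1]
    · have hir : i = r := by omega
      rw [Function.update_of_ne h, hir]
      exact hσ r (by simp only [Finset.mem_Icc]; omega)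
  have hcongr1 : (∫⋯∫⁻_Finset.Icc (ℓ + 1) (ℓ + N), (fun σ => P ℓ N σ * J σ) ∂fun _ : ℤ => ν) η =
      (∫⋯∫⁻_Finset.Icc (ℓ + 1) (ℓ + N), (fun σ => P ℓ N σ * F (σ (ℓ + N))) ∂fun _ : ℤ => ν) η :=
    lmarginal_congr_of_forall_eq η fun σ hσ => by rw [hJF σ hσ]
  have hstep1 : (∫⋯∫⁻_Finset.Icc (ℓ + 1) (r - 1), (fun σ => Φ σ *
      ((∏ x ∈ Finset.Icc (ℓ + 1) (r - 1), w (σ x)) * ∏ y ∈ Finset.Icc ℓ (r - 1), k (σ y) (σ (y + 1))))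
      ∂fun _ : ℤ => ν) η = (κ^[N] F) (η ℓ) := by
    rw [h0, hvol1, lmarginal_union _ _ hIm hdisj1, hinner1, hcongr1, hPpeel ℓ N F hFm η]
  -- Step 2: identify `F x` as `∫⁻ m(x, y) w(y) g(y)`
  have hFid : F = fun x => ∫⁻ y, (∫⋯∫⁻_Finset.Icc a (b - 1), (fun σ => Φ σ *
      ((∏ i ∈ Finset.range n, k (σ (a - 1 + i)) (σ (a - 1 + i + 1)) * w (σ (a - 1 + i + 1))) *
        k (σ (b - 1)) (σ b))) ∂fun _ : ℤ => ν)
      (Function.update (Function.update η₀ (a - 1) x) b y) * w y * g y ∂ν := by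
    funext x
    simp only [hF, hJ]
    set ηx : ℤ → S := Function.update η (a - 1) x with hηx
    have hηxr : ηx r = η r := by rw [hηx, Function.update_of_ne (by omega)]
    have hηxa : ηx (a - 1) = x := by rw [hηx, Function.update_self]
    -- split window / right block
    have hvol2 : Finset.Icc a (r - 1) = Finset.Icc a b ∪ Finset.Icc (b + 1) (b + N) := by
      ext i; simp only [Finset.mem_union, Finset.mem_Icc]; omega
    have hdisj2 : Disjoint (Finset.Icc a b) (Finset.Icc (b + 1) (b + N)) := by
      rw [Finset.disjoint_left]; intro i hi hi'; simp only [Finset.mem_Icc] at hi hi'; omega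
    have hdisj2' : Disjoint (Finset.Icc (b + 1) (b + N)) (Finset.Icc (a - 1) b) := by
      rw [Finset.disjoint_left]; intro i hi hi'; simp only [Finset.mem_Icc] at hi hi'; omega
    have hI2 : (fun σ : ℤ → S => Φ σ * (P (a - 1) (n + 1 + N) σ * k (σ (r - 1)) (σ r))) =
        fun σ => (Φ σ * P (a - 1) (n + 1) σ) * (P b N σ * k (σ (b + N)) (σ r)) := by
      funext σ; rw [hPadd (a - 1) (n + 1) N, e2, e4]; ring
    have hWd : DependsOn (fun σ : ℤ → S => Φ σ * P (a - 1) (n + 1) σ)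
        (↑(Finset.Icc (a - 1) b) : Set ℤ) := by
      intro x' y' hxy
      have hΦ' : Φ x' = Φ y' := hΦd fun i hi => hxy i (by
        simp only [Finset.coe_Icc, Set.mem_Icc] at hi ⊢; omega)
      have hP' : P (a - 1) (n + 1) x' = P (a - 1) (n + 1) y' := hPd _ _ fun i hi => hxy i (by
        simp only [Finset.coe_Icc, Set.mem_Icc] at hi ⊢; push_cast at hi; omega)
      simp only [hΦ', hP']
    have hRm : Measurable fun σ : ℤ → S => P b N σ * k (σ (b + N)) (σ r) :=
      (hPm _ _).mul (hkij _ _)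
    have hI2m' : Measurable fun σ : ℤ → S => (Φ σ * P (a - 1) (n + 1) σ) *
        (P b N σ * k (σ (b + N)) (σ r)) := (hΦ.mul (hPm _ _)).mul hRm
    have hinner2 : (∫⋯∫⁻_Finset.Icc (b + 1) (b + N), (fun σ => (Φ σ * P (a - 1) (n + 1) σ) *
        (P b N σ * k (σ (b + N)) (σ r))) ∂fun _ : ℤ => ν) =
        fun τ => (Φ τ * P (a - 1) (n + 1) τ) * (κ^[N] fun z => k z (τ r)) (τ b) := by
      funext τ
      rw [lmarginal_mul_left_of_dependsOn' (ν := ν) hWd hdisj2' hRm τ]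
      congr 1
      rw [← hPpeel b N (fun z => k z (τ r)) (hkr _) τ]
      exact lmarginal_congr_of_forall_eq τ fun σ hσ => by
        rw [hσ r (by simp only [Finset.mem_Icc]; omega)]
    have hWm : Measurable fun τ : ℤ → S => (Φ τ * P (a - 1) (n + 1) τ) * g (τ b) :=
      (hΦ.mul (hPm _ _)).mul (hgm.comp (measurable_pi_apply b))
    -- the window, with its last site outermost
    have hvol3 : Finset.Icc a b = insert b (Finset.Icc a (b - 1)) := by
      ext i; simp only [Finset.mem_insert, Finset.mem_Icc]; omega
    have hnot3 : b ∉ Finset.Icc a (b - 1) := by simp only [Finset.mem_Icc]; omega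
    have hcore : (fun τ : ℤ → S => (Φ τ * P (a - 1) (n + 1) τ) * g (τ b)) =
        fun τ => (Φ τ * ((∏ i ∈ Finset.range n, k (τ (a - 1 + i)) (τ (a - 1 + i + 1)) *
          w (τ (a - 1 + i + 1))) * k (τ (b - 1)) (τ b))) * (w (τ b) * g (τ b)) := by
      funext τ; rw [hPsucc, e5, e6, hP]; ring
    have hgbd : DependsOn (fun τ : ℤ → S => w (τ b) * g (τ b)) (↑({b} : Finset ℤ) : Set ℤ) := by
      intro x' y' hxy; simp only [hxy b (by simp)]
    have hdisj3 : Disjoint (Finset.Icc a (b - 1)) {b} := by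
      rw [Finset.disjoint_singleton_right]; exact hnot3
    have hCm : Measurable fun τ : ℤ → S => Φ τ * ((∏ i ∈ Finset.range n,
        k (τ (a - 1 + i)) (τ (a - 1 + i + 1)) * w (τ (a - 1 + i + 1))) * k (τ (b - 1)) (τ b)) :=
      hΦ.mul ((measurable_pathWeight hk hw _ _).mul (hkij _ _))
    have hCd : DependsOn (fun τ : ℤ → S => Φ τ * ((∏ i ∈ Finset.range n,
        k (τ (a - 1 + i)) (τ (a - 1 + i + 1)) * w (τ (a - 1 + i + 1))) * k (τ (b - 1)) (τ b)))
        (↑(Finset.Icc (a - 1) b) : Set ℤ) := by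
      intro x' y' hxy
      simp only [Finset.coe_Icc, Set.mem_Icc] at hxy
      have hΦ' : Φ x' = Φ y' := hΦd fun i hi => hxy i (by
        simp only [Finset.coe_Icc, Set.mem_Icc] at hi ⊢; omega)
      have hP' := dependsOn_pathWeight (k := k) (w := w) (a - 1) n (fun i hi => hxy i (by
        simp only [Finset.coe_Icc, Set.mem_Icc] at hi ⊢; omega))
      simp only at hP'
      dsimp only
      rw [hΦ', hP', hxy (b - 1) ⟨by omega, by omega⟩, hxy b ⟨by omega, le_rfl⟩]
    calc (∫⋯∫⁻_Finset.Icc a (r - 1), (fun σ => Φ σ * (P (a - 1) (n + 1 + N) σ *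
          k (σ (r - 1)) (σ r))) ∂fun _ : ℤ => ν) ηx
        = (∫⋯∫⁻_Finset.Icc a b, (fun τ => (Φ τ * P (a - 1) (n + 1) τ) *
            (κ^[N] fun z => k z (τ r)) (τ b)) ∂fun _ : ℤ => ν) ηx := by
          rw [hI2, hvol2, lmarginal_union _ _ hI2m' hdisj2, hinner2]
      _ = (∫⋯∫⁻_Finset.Icc a b, (fun τ => (Φ τ * P (a - 1) (n + 1) τ) * g (τ b))
            ∂fun _ : ℤ => ν) ηx :=
          lmarginal_congr_of_forall_eq ηx fun τ hτ => by
            rw [hτ r (by simp only [Finset.mem_Icc]; omega), hηxr]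
      _ = ∫⁻ y, (∫⋯∫⁻_Finset.Icc a (b - 1), (fun τ => (Φ τ * P (a - 1) (n + 1) τ) * g (τ b))
            ∂fun _ : ℤ => ν) (Function.update ηx b y) ∂ν := by
          rw [hvol3, lmarginal_insert _ hWm hnot3]
      _ = _ := by
          refine lintegral_congr fun y => ?_
          rw [hcore, lmarginal_mul_right_of_dependsOn' (ν := ν) hgbd hdisj3 hCm,
            Function.update_self, ← mul_assoc]
          congr 2
          refine dependsOn_lmarginal (μ := fun _ : ℤ => ν) _ hCd fun i hi => ?_
          simp only [Set.mem_sdiff, Finset.coe_Icc, Set.mem_Icc, not_and, not_le] at hi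
          rcases eq_or_ne i b with h | h
          · rw [h, Function.update_self, Function.update_self]
          · have hia : i = a - 1 := by omega
            rw [Function.update_of_ne h, Function.update_of_ne h, hia, hηxa,
              Function.update_self]
  rw [hstep1, hFid]

end Literature.MathematicalPhysics.KineticTheory.HeatConduction

end
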